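import Mathlib.Tactic.Linarith
import Summits.CriticalPhenomena.PercolationContinuityZ3.Theorems.PercNearOneGluingNoHeavyLowerTailSahiCTCNcSplit
import HarnessLib

/-!
# `NoHeavyLowerTail` (crux stmt-CriticalPhenomena-4575), P3 lane: SPLITTING AN UP-SET ALONG ITS LOOPS (dictionary for the co-level-1 theorem) —
# `GF(𝒳) = GF(meets L) + GF(X₀')`, `Π = GF(meets L) + Π_{V∖L}`, inclusion–exclusion on `2^{V∖L}`, and the counting lemma `(Π−1)·W_L ≤ e₁·GF(meets L)`

Support file (seat `prim-l12-p3`, gen 24; `--supports stmt-CriticalPhenomena-4575`).  Memo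
`run/shared/lean/prim/prim-l12/FROM-prim-l12-p3-g24-VALUE-LEVEL-TH2K.md` §3.  Used by the companion `…SahiCTCCoLevelOne` (the theorem
`M₁(𝒳,𝒵) ∈ ℕ[s]` for every pair of up-sets = the complement-dual of CTC_{k−1}(k) for every `k`).

Language: up-sets `𝒳` of OPEN sets (memo g23 §3); `L ⊆ V` a set of vertices (the common loops `{u : {u} ∈ 𝒳 ∩ 𝒵}` = `loops 𝒳 𝒵`);
`meets L = {S : S ∩ L ≠ ∅}` (so `GF(meets L) = Π − Π_{V∖L}`), `avoid L 𝒳 = {S ∈ 𝒳 : S ⊆ V∖L}`, `singles L = {{u} : u ∈ L}` (`GF = W_L = Σ_{u∈L} s_u`),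
`empPart 𝒳 = 𝒳 ∩ {∅}`.  THIS FILE:
* `gf_eq_meets_add_avoid` : an up-set containing the singletons of `L` but not `∅` is `meets L ⊔ avoid L 𝒳`;
* `PiP_eq_meets_add`, `gf_powerset_compl_eq` (inclusion–exclusion `Π_{V∖L} = GF(N₀') + GF(X₀') + GF(Z₀') − GF(X₀'∩Z₀')`), `avoid_inter`;
* **`coeff_countingLemma_nonneg`** : `e₁·GF(meets L) − (Π−1)·W_L ∈ ℕ[s]` by the explicit injection `(B,{u}) ↦ ({u},B)` if `B` meets `L`, else
  `({v}, B∖{v} ∪ {u})` for a fixed `v ∈ B` (memo §3(c));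
* small facts (`eq_univ_powerset_of_empty_mem`, `PiP_eq_gf_erase_add_one`, `empPart_eq_*`, `gf_singleton_empty`, `gf_empty`).
Nothing is asserted about the crux.
-/

namespace Summit.CriticalPhenomena.PercolationContinuityZ3.Theorems.SahiCTCForms

open Finset MvPolynomial SahiCTCGenFun

variable {α : Type*} [DecidableEq α] [Fintype α]

/-! ### The co-level-1 dictionary (up-sets of OPEN sets) -/

/-- The sets meeting `L`: `{S : S ∩ L ≠ ∅}` (the up-set generated by the singletons of `L`). [this work] -/
def meets (L : Finset α) : Finset (Finset α) := univ.powerset.filter fun S => (S ∩ L).Nonempty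

/-- The members of `F` avoiding `L`. [this work] -/
def avoid (L : Finset α) (F : Finset (Finset α)) : Finset (Finset α) := F.filter fun S => S ⊆ univ \ L

/-- The singletons `{u}`, `u ∈ L`, as a set family (its generating function is `Σ_{u∈L} s_u`). [this work] -/
def singles (L : Finset α) : Finset (Finset α) := univ.powerset.filter fun S => ∃ u ∈ L, S = {u}

/-- The common loops of two families: `{u : {u} ∈ 𝒳 ∩ 𝒵}`. [this work] -/
def loops (𝒳 𝒵 : Finset (Finset α)) : Finset α := univ.filter fun u => ({u} : Finset α) ∈ 𝒳 ∧ ({u} : Finset α) ∈ 𝒵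

/-- The empty-set part of a family: `{∅} ∩ 𝒳`. [this work] -/
def empPart (𝒳 : Finset (Finset α)) : Finset (Finset α) := 𝒳.filter fun S => S = ∅

/-! ### Small facts -/

/-- `loops` is symmetric. [this work] -/
theorem loops_comm (𝒳 𝒵 : Finset (Finset α)) : loops 𝒳 𝒵 = loops 𝒵 𝒳 := by
  unfold loops; congr 1; ext u; tauto

omit [DecidableEq α] [Fintype α] in
/-- `GF({∅}) = 1`. [this work] -/
theorem gf_singleton_empty : gf ({∅} : Finset (Finset α)) = 1 := by
  unfold gf; rw [sum_singleton]; unfold SahiCTCGenFun.ind; rw [sum_empty]; rfl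

omit [Fintype α] in
/-- The empty-set part of a family not containing `∅` is empty. [this work] -/
theorem empPart_eq_empty {𝒳 : Finset (Finset α)} (h : ∅ ∉ 𝒳) : empPart 𝒳 = ∅ := by
  unfold empPart; exact filter_eq_empty_iff.2 fun S hS hS0 => h (hS0 ▸ hS)

omit [Fintype α] in
/-- The empty-set part of a family containing `∅` is `{∅}`. [this work] -/
theorem empPart_eq_singleton {𝒳 : Finset (Finset α)} (h : ∅ ∈ 𝒳) : empPart 𝒳 = {∅} := by
  unfold empPart; ext S; simp only [mem_filter, mem_singleton]
  constructor
  · rintro ⟨_, rfl⟩; rfl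
  · rintro rfl; exact ⟨h, rfl⟩

omit [DecidableEq α] [Fintype α] in
/-- `GF(∅) = 0`. [this work] -/
theorem gf_empty : gf (∅ : Finset (Finset α)) = 0 := by unfold gf; rw [sum_empty]

omit [DecidableEq α] in
/-- An up-set containing `∅` is the whole power set. [this work] -/
theorem eq_univ_powerset_of_empty_mem {𝒳 : Finset (Finset α)} (h𝒳 : IsUpperSet (𝒳 : Set (Finset α))) (h : ∅ ∈ 𝒳) :
    𝒳 = univ.powerset := by
  ext S; simp only [mem_powerset, subset_univ, iff_true]
  exact h𝒳 (empty_subset S) h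

/-- `Π = GF(2^V ∖ {∅}) + 1`. [this work] -/
theorem PiP_eq_gf_erase_add_one : (PiP : MvPolynomial α ℤ) = gf ((univ.powerset : Finset (Finset α)).erase ∅) + 1 := by
  unfold PiP
  rw [← gf_singleton_empty, ← gf_union (disjoint_singleton_right.2 (notMem_erase ∅ _))]
  congr 1
  ext S; simp only [mem_union, mem_erase, mem_singleton, mem_powerset, subset_univ]; tauto

/-- A set meeting the common loops lies in the up-set. [this work] -/
theorem mem_of_mem_meets {𝒳 : Finset (Finset α)} (h𝒳 : IsUpperSet (𝒳 : Set (Finset α))) {L : Finset α}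
    (hL : ∀ u ∈ L, ({u} : Finset α) ∈ 𝒳) {S : Finset α} (hS : S ∈ meets L) : S ∈ 𝒳 := by
  obtain ⟨u, hu⟩ := (mem_filter.1 hS).2
  obtain ⟨huS, huL⟩ := mem_inter.1 hu
  exact h𝒳 (singleton_subset_iff.2 huS) (hL u huL)

/-- Loops of `𝒳`. [this work] -/
theorem singleton_mem_left_of_mem_loops {𝒳 𝒵 : Finset (Finset α)} {u : α} (hu : u ∈ loops 𝒳 𝒵) : ({u} : Finset α) ∈ 𝒳 :=
  ((mem_filter.1 hu).2).1

/-- Loops of `𝒵`. [this work] -/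
theorem singleton_mem_right_of_mem_loops {𝒳 𝒵 : Finset (Finset α)} {u : α} (hu : u ∈ loops 𝒳 𝒵) : ({u} : Finset α) ∈ 𝒵 :=
  ((mem_filter.1 hu).2).2

/-- An up-set not containing `∅` splits into the sets meeting its loops `L` and its members avoiding `L`. [this work] -/
theorem gf_eq_meets_add_avoid {𝒳 : Finset (Finset α)} (h𝒳 : IsUpperSet (𝒳 : Set (Finset α))) {L : Finset α}
    (hL : ∀ u ∈ L, ({u} : Finset α) ∈ 𝒳) : gf 𝒳 = gf (meets L) + gf (avoid L 𝒳) := by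
  rw [← gf_union]
  · congr 1
    ext S
    simp only [mem_union, meets, avoid, mem_filter, mem_powerset, subset_univ, true_and]
    constructor
    · intro hS
      by_cases h : (S ∩ L).Nonempty
      · exact Or.inl h
      · refine Or.inr ⟨hS, fun x hx => mem_sdiff.2 ⟨mem_univ _, fun hxL => h ⟨x, mem_inter.2 ⟨hx, hxL⟩⟩⟩⟩
    · rintro (h | ⟨hS, _⟩)
      · exact mem_of_mem_meets h𝒳 hL (mem_filter.2 ⟨mem_powerset.2 (subset_univ _), h⟩)
      · exact hS
  · rw [disjoint_left]
    intro S h1 h2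
    obtain ⟨u, hu⟩ := (mem_filter.1 h1).2
    obtain ⟨huS, huL⟩ := mem_inter.1 hu
    have := (mem_filter.1 h2).2 huS
    exact (mem_sdiff.1 this).2 huL

/-- `Π = GF(meets L) + GF(2^{V∖L})`. [this work] -/
theorem PiP_eq_meets_add (L : Finset α) : (PiP : MvPolynomial α ℤ) = gf (meets L) + gf ((univ \ L).powerset) := by
  unfold PiP
  rw [← gf_union]
  · congr 1
    ext S
    simp only [mem_union, meets, mem_filter, mem_powerset, subset_univ, true_and]
    constructor
    · intro _
      by_cases h : (S ∩ L).Nonempty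
      · exact Or.inl h
      · exact Or.inr fun x hx => mem_sdiff.2 ⟨mem_univ _, fun hxL => h ⟨x, mem_inter.2 ⟨hx, hxL⟩⟩⟩
    · intro _; trivial
  · rw [disjoint_left]
    intro S h1 h2
    obtain ⟨u, hu⟩ := (mem_filter.1 h1).2
    obtain ⟨huS, huL⟩ := mem_inter.1 hu
    exact (mem_sdiff.1 (mem_powerset.1 h2 huS)).2 huL

/-- `avoid L (𝒳 ∩ 𝒵) = avoid L 𝒳 ∩ avoid L 𝒵`. [this work] -/
theorem avoid_inter (L : Finset α) (𝒳 𝒵 : Finset (Finset α)) : avoid L (𝒳 ∩ 𝒵) = avoid L 𝒳 ∩ avoid L 𝒵 := by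
  unfold avoid; ext S; simp only [mem_filter, mem_inter]; tauto

/-- Inclusion–exclusion on `2^{V∖L}`: `GF(2^{V∖L}) = GF(N₀') + GF(X₀) + GF(Z₀) − GF(X₀ ∩ Z₀)` with `N₀'` the sets avoiding `L` in neither family.
[this work] -/
theorem gf_powerset_compl_eq (L : Finset α) (𝒳 𝒵 : Finset (Finset α)) :
    gf ((univ \ L).powerset) = gf (((univ \ L).powerset).filter fun S => S ∉ 𝒳 ∧ S ∉ 𝒵) + gf (avoid L 𝒳) + gf (avoid L 𝒵)
      - gf (avoid L 𝒳 ∩ avoid L 𝒵) := by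
  have h1 : gf (avoid L 𝒵) = gf (avoid L 𝒵 \ avoid L 𝒳) + gf (avoid L 𝒳 ∩ avoid L 𝒵) := by
    rw [← gf_union]
    · congr 1; ext S; simp only [mem_union, mem_sdiff, mem_inter]; tauto
    · rw [disjoint_left]; intro S hS hS'; exact (mem_sdiff.1 hS).2 (mem_inter.1 hS').1
  have h2 : gf ((univ \ L).powerset) = gf (((univ \ L).powerset).filter fun S => S ∉ 𝒳 ∧ S ∉ 𝒵) +
      (gf (avoid L 𝒳) + gf (avoid L 𝒵 \ avoid L 𝒳)) := by
    rw [← gf_union, ← gf_union]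
    · congr 1; ext S
      simp only [mem_union, mem_filter, mem_sdiff, avoid, mem_powerset]
      constructor
      · intro hS
        by_cases hX : S ∈ 𝒳
        · exact Or.inr (Or.inl ⟨hX, hS⟩)
        · by_cases hZ : S ∈ 𝒵
          · exact Or.inr (Or.inr ⟨⟨hZ, hS⟩, fun h => hX h.1⟩)
          · exact Or.inl ⟨hS, hX, hZ⟩
      · rintro (⟨hS, _⟩ | ⟨_, hS⟩ | ⟨⟨_, hS⟩, _⟩) <;> exact hS
    · rw [disjoint_left]; intro S hS hS'
      simp only [mem_union, avoid, mem_filter, mem_sdiff] at hS hS'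
      rcases hS' with ⟨hX, _⟩ | ⟨⟨hZ, _⟩, _⟩
      · exact hS.2.1 hX
      · exact hS.2.2 hZ
    · rw [disjoint_left]; intro S hS hS'; exact (mem_sdiff.1 hS').2 hS
  rw [h2, h1]; ring

/-! ### The counting lemma `(Π−1)·W_L ≤ e₁·GF(meets L)` -/

/-- Membership in `singles L`. [this work] -/
theorem mem_singles {L : Finset α} {S : Finset α} : S ∈ singles L ↔ ∃ u ∈ L, S = {u} := by
  unfold singles; simp only [mem_filter, mem_powerset, subset_univ, true_and]

omit [DecidableEq α] in
/-- A singleton is a set of size one. [this work] -/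
theorem singleton_mem_bySize_one (v : α) : ({v} : Finset α) ∈ (bySize (· = 1) : Finset (Finset α)) := by
  unfold bySize; exact mem_filter.2 ⟨mem_powerset.2 (subset_univ _), card_singleton v⟩

/-- **Counting lemma** (memo g24 §3(c)): every coefficient of `(Π−1)·W_L` is at most that of `e₁·GF(meets L)`; an explicit injection of the
pairs `(B, {u})` (`B ≠ ∅`, `u ∈ L`) into pairs `({v}, A)` (`A` meeting `L`) with the same profile. [this work] -/
theorem coeff_PiPsub_mul_singles_le (L : Finset α) (n : α →₀ ℕ) :
    (gf ((univ.powerset : Finset (Finset α)).erase ∅) * gf (singles L)).coeff n ≤ (ee 1 * gf (meets L)).coeff n := by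
  unfold ee
  rw [coeff_gf_mul_gf, coeff_gf_mul_gf]
  -- the map
  classical
  let φ : Finset α × Finset α → Finset α × Finset α := fun BS =>
    if h : (BS.1 ∩ L).Nonempty then (BS.2, BS.1)
    else if hB : BS.1.Nonempty then ({hB.choose}, (BS.1.erase hB.choose) ∪ BS.2) else (BS.2, BS.1)
  refine Nat.cast_le.2 (card_le_card_of_injOn φ (fun BS hBS => ?_) (fun BS hBS BS' hBS' heq => ?_))
  · -- maps into the target
    obtain ⟨hmem, hsum⟩ := mem_filter.1 (Finset.mem_coe.1 hBS)
    obtain ⟨hB, hS⟩ := mem_product.1 hmem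
    obtain ⟨u, huL, hSu⟩ := mem_singles.1 hS
    have hBne : BS.1.Nonempty := nonempty_iff_ne_empty.2 (mem_erase.1 hB).1
    rw [Finset.mem_coe, mem_filter, mem_product]
    by_cases h : (BS.1 ∩ L).Nonempty
    · simp only [φ, dif_pos h]
      refine ⟨⟨hSu ▸ singleton_mem_bySize_one u, mem_filter.2 ⟨mem_powerset.2 (subset_univ _), h⟩⟩, ?_⟩
      rw [add_comm]; exact hsum
    · simp only [φ, dif_neg h, dif_pos hBne]
      set v := hBne.choose with hv
      have hvB : v ∈ BS.1 := hBne.choose_spec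
      have hvL : v ∉ L := fun hvL => h ⟨v, mem_inter.2 ⟨hvB, hvL⟩⟩
      have huB : u ∉ BS.1 := fun huB => h ⟨u, mem_inter.2 ⟨huB, huL⟩⟩
      have huv : u ≠ v := fun huv => hvL (huv ▸ huL)
      refine ⟨⟨singleton_mem_bySize_one v, mem_filter.2 ⟨mem_powerset.2 (subset_univ _), ⟨u, mem_inter.2 ⟨?_, huL⟩⟩⟩⟩, ?_⟩
      · rw [hSu]; exact mem_union_right _ (mem_singleton_self u)
      · rw [← hsum, hSu]
        ext x
        simp only [Finsupp.add_apply, ind_apply, mem_singleton, mem_union, mem_erase]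
        by_cases hxv : x = v
        · subst hxv; simp [hvB, huv.symm]
        · by_cases hxu : x = u
          · subst hxu; simp [huB, huv]
          · simp [hxv, hxu]
  · -- injective
    obtain ⟨hmem, _⟩ := mem_filter.1 (Finset.mem_coe.1 hBS)
    obtain ⟨hB, hS⟩ := mem_product.1 hmem
    obtain ⟨u, huL, hSu⟩ := mem_singles.1 hS
    have hBne : BS.1.Nonempty := nonempty_iff_ne_empty.2 (mem_erase.1 hB).1
    obtain ⟨hmem', _⟩ := mem_filter.1 (Finset.mem_coe.1 hBS')
    obtain ⟨hB', hS'⟩ := mem_product.1 hmem'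
    obtain ⟨u', huL', hSu'⟩ := mem_singles.1 hS'
    have hBne' : BS'.1.Nonempty := nonempty_iff_ne_empty.2 (mem_erase.1 hB').1
    by_cases h : (BS.1 ∩ L).Nonempty
    · by_cases h' : (BS'.1 ∩ L).Nonempty
      · simp only [φ, dif_pos h, dif_pos h'] at heq
        exact Prod.ext (Prod.ext_iff.1 heq).2 (Prod.ext_iff.1 heq).1
      · simp only [φ, dif_pos h, dif_neg h', dif_pos hBne'] at heq
        -- {u} side: BS.2 = {v'} with v' ∉ L but BS.2 = {u}, u ∈ L
        have e1 := (Prod.ext_iff.1 heq).1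
        have hv'L : hBne'.choose ∉ L := fun hvL => h' ⟨_, mem_inter.2 ⟨hBne'.choose_spec, hvL⟩⟩
        rw [hSu] at e1
        have : u = hBne'.choose := singleton_injective e1
        exact absurd (this ▸ huL) hv'L
    · by_cases h' : (BS'.1 ∩ L).Nonempty
      · simp only [φ, dif_neg h, dif_pos hBne, dif_pos h'] at heq
        have e1 := (Prod.ext_iff.1 heq).1
        have hvL : hBne.choose ∉ L := fun hvL => h ⟨_, mem_inter.2 ⟨hBne.choose_spec, hvL⟩⟩
        rw [hSu'] at e1
        have : hBne.choose = u' := singleton_injective e1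
        exact absurd (this ▸ huL') hvL
      · simp only [φ, dif_neg h, dif_neg h', dif_pos hBne, dif_pos hBne'] at heq
        obtain ⟨e1', e2⟩ := Prod.ext_iff.1 heq
        simp only at e1' e2
        have e1 : hBne.choose = hBne'.choose := singleton_injective e1'
        have hvB : hBne.choose ∈ BS.1 := hBne.choose_spec
        have hvB' : hBne.choose ∈ BS'.1 := by rw [e1]; exact hBne'.choose_spec
        have huB : u ∉ BS.1 := fun huB => h ⟨u, mem_inter.2 ⟨huB, huL⟩⟩
        have huB' : u' ∉ BS'.1 := fun huB => h' ⟨u', mem_inter.2 ⟨huB, huL'⟩⟩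
        rw [← e1, hSu, hSu'] at e2
        -- e2 : BS.1.erase v ∪ {u} = BS'.1.erase v ∪ {u'}; the unique `L`-element of both sides is `u = u'`
        have huu : u = u' := by
          have hu_mem : u ∈ BS.1.erase hBne.choose ∪ {u} := mem_union_right _ (mem_singleton_self u)
          rw [e2] at hu_mem
          rcases mem_union.1 hu_mem with hh | hh
          · exact absurd (mem_erase.1 hh).2 (fun huB1 => h' ⟨u, mem_inter.2 ⟨huB1, huL⟩⟩)
          · exact mem_singleton.1 hh
        subst huu
        have hB_eq : BS.1 = BS'.1 := by
          ext x
          constructor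
          · intro hx
            by_cases hxv : x = hBne.choose
            · rw [hxv]; exact hvB'
            · have hx' : x ∈ BS.1.erase hBne.choose ∪ {u} := mem_union_left _ (mem_erase.2 ⟨hxv, hx⟩)
              rw [e2] at hx'
              rcases mem_union.1 hx' with hh | hh
              · exact (mem_erase.1 hh).2
              · rw [mem_singleton.1 hh] at hx; exact absurd hx huB
          · intro hx
            by_cases hxv : x = hBne.choose
            · rw [hxv]; exact hvB
            · have hx' : x ∈ BS'.1.erase hBne.choose ∪ {u} := mem_union_left _ (mem_erase.2 ⟨hxv, hx⟩)
              rw [← e2] at hx'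
              rcases mem_union.1 hx' with hh | hh
              · exact (mem_erase.1 hh).2
              · rw [mem_singleton.1 hh] at hx; exact absurd hx huB'
        exact Prod.ext hB_eq (by rw [hSu, hSu'])

/-- **`e₁·GF(meets L) − (Π−1)·W_L ∈ ℕ[s]`.** [this work] -/
theorem coeff_countingLemma_nonneg (L : Finset α) (n : α →₀ ℕ) :
    0 ≤ (ee 1 * gf (meets L) - (PiP - 1) * gf (singles L)).coeff n := by
  rw [PiP_eq_gf_erase_add_one, add_sub_cancel_right, coeff_sub, sub_nonneg]
  exact coeff_PiPsub_mul_singles_le L n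

end Summit.CriticalPhenomena.PercolationContinuityZ3.Theorems.SahiCTCForms
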